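import Literature.AnabelianGeometry.EtaleTheta.Discharge.Sec3Thm37Cnst
import HarnessLib

/-!
# [EtTh] Theorem 3.7 at ONE facade: the instantiation `FrobenioidFacade.withCnst` does not touch the
# (i)/(ii) clauses (bookkeeping, proof-only)

Proof-only companion of `TemperedFrobenioidCnst.lean` / `Discharge/Sec3Thm37Cnst.lean` (abc-iut-L2-t3).
S. Mochizuki, *The étale theta function …*, Publ. RIMS **45** (2009) [EtTh], Thm. 3.7, PDF pp.79–80
[cite: MochizukiEtTh2009, Thm 3.7 p.79].  The typed clauses `Thm37_i F`, `Thm37_ii F` read only the [FrdI] type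
predicates of the facade `F`, which `F.withCnst K` keeps; so every discharge of (i)/(ii) obtained for a facade `F`
(e.g. abc-iut-w5-d164's `thm37_i_unitConjuncts_ofRlfR`, the tree-vocabulary closers) transfers verbatim to the
instantiated facade at which (iii) is proved (`thm37_iii_withCnst`), and the three clauses can be stated at a
single facade.  `Iff.rfl`-level; no definitions.  HONEST FRAMING: bookkeeping; nothing of [EtTh] is asserted
beyond what the cited theorems prove; nothing here bears on [IUTchIII] Cor. 3.12.
-/

namespace Literature.AnabelianGeometry.EtaleTheta

open CategoryTheory Opposite Literature.AlgebraicGeometry.Frobenioids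

namespace TemperedFrobenioid

universe u₀ v₀ u₁ v₁ u v w

variable {D₀ : Type u₀} [Category.{v₀} D₀] {V : FrdIMonoidStub.{w}}
  {T : RealifiedDivisorMonoids (D₀ := D₀) V} {D : Type u} [Category.{v} D]
  {VD : FrdICatStub.{u, v, w} D} (C₀ : TemperedFrobenioid T D VD)
  {Dc : Type u₁} [Category.{v₁} Dc]

/-- `Thm37_i` is unchanged by instantiating the (iii)-fields of the facade. [cite: MochizukiEtTh2009, Thm 3.7 p.79] -/
theorem thm37_i_withCnst_iff (F : FrobenioidFacade.{u, v, w} D) (K : D ⥤ Dc) :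
    C₀.Thm37_i (F.withCnst K) ↔ C₀.Thm37_i F :=
  Iff.rfl

/-- `Thm37_ii` is unchanged by instantiating the (iii)-fields of the facade. [cite: MochizukiEtTh2009, Thm 3.7 p.79] -/
theorem thm37_ii_withCnst_iff (F : FrobenioidFacade.{u, v, w} D) (K : D ⥤ Dc) :
    C₀.Thm37_ii (F.withCnst K) ↔ C₀.Thm37_ii F :=
  Iff.rfl

/-- **Theorem 3.7 (i)(ii)(iii) at one facade**: discharges of (i) and (ii) for `F`, plus the Prop. 3.4 (ii)
clauses `Prop34Cnst` for (iii), give all three typed clauses at the instantiated facade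
`F.withCnst ((D → D₀) ⋙ cnst)`. [cite: MochizukiEtTh2009, Thm 3.7 p.79] -/
theorem thm37_i_ii_iii_withCnst {Dcnst : Type u₁} [Category.{v₁} Dcnst] {cnst : D₀ ⥤ Dcnst}
    (F : FrobenioidFacade.{u, v, w} D) (hi : C₀.Thm37_i F) (hii : C₀.Thm37_ii F)
    (P : T.Prop34Cnst cnst) :
    C₀.Thm37_i (F.withCnst (C₀.base ⋙ cnst)) ∧ C₀.Thm37_ii (F.withCnst (C₀.base ⋙ cnst)) ∧
      C₀.Thm37_iii (F.withCnst (C₀.base ⋙ cnst)) :=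
  ⟨hi, hii, C₀.thm37_iii_withCnst F P⟩

end TemperedFrobenioid

end Literature.AnabelianGeometry.EtaleTheta
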